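import Summits.AtomisticToContinuum.FouriersLaw.Theorems.OddSectorIrreversibilityResponseDensityDualityError

/-!
# Detailed balance of the equilibrium kernels of the pinned chain, for `C_c^∞` observables

Helper file for item stmt-AtomisticToContinuum-9144 (`ResponseDensity`, route
`OddSectorIrreversibility`, sub-problem `FouriersLaw` of `AtomisticToContinuum`): the core of the
detailed-balance (hDUAL) line. Both baths at `T > 0`, `π = e^{-H/T}`, `Θ(q,p) = (q,-p)`:

* `pinnedChain_integral_transitionKernel_zero` — `P_0 f = f`;
* `pinnedChain_detailedBalance_smooth` — **for `F, G ∈ C_c^∞` and `t ≥ 0`,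
  `∫ π G · P_t F dx = ∫ π (F∘Θ) · P_t(G∘Θ) dx`.**

Proof (`t > 0`): `Ψ_R(s) = ∫ π χ_R w_{t-s}(Θx) u_s(x) dx` (`u_s = P_s F`, `w_r = P_r(G∘Θ)`) has derivative a
cutoff error (`…DualityError.lean`) whose integral over `[s₀, t-s₀]` is `≤ t A(η)/R + B η (1+t)` (energy
estimate `…EnergyCutoff.lean`); `R → ∞`, `η → 0`, then `s₀ → 0` and a momentum flip give the claim.

No definitions.
-/

noncomputable section

open MeasureTheory ProbabilityTheory Filter Topology Set Function Metric
open scoped NNReal ENNReal ContDiff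

namespace Summit.AtomisticToContinuum.FouriersLaw.Theorems

open Literature.MathematicalPhysics.KineticTheory.HeatConduction
open Literature.Probability.Process Literature.MathematicalPhysics.KineticTheory OscillatorChain

variable {N : ℕ}

section Core

variable {ω₂ lam β γ : ℝ} (hω : 0 < ω₂) (hl : 0 ≤ lam) (hβ : 0 ≤ β) (hγ : 0 < γ) (hN : 0 < N)
  {T : ℝ} (hT : 0 < T)
include hω hl hβ hγ

/-- `P_0 f(x) = f(x)` for continuous `f` (the flow at time `0` is the identity). -/
theorem pinnedChain_integral_transitionKernel_zero (T_L T_R : ℝ) {f : PhaseSpace N → ℝ} (hf : Continuous f)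
    (x : PhaseSpace N) :
    ∫ y, f y ∂((pinnedChain ω₂ lam β γ).transitionKernel N T_L T_R (0 : ℝ).toNNReal x) = f x := by
  rw [pinnedChain_integral_transitionKernel hω hl hβ hγ.le N T_L T_R _ x hf.aestronglyMeasurable]
  have h : ∀ w, (pinnedChain ω₂ lam β γ).solMap N T_L T_R ((0 : ℝ).toNNReal : ℝ) x w = x := fun w =>
    pinnedChain_solMap_of_nonpos N T_L T_R x w (by simp)
  simp only [h, integral_const, smul_eq_mul]
  simp

include hN hT

/-- **Detailed balance for `C_c^∞` observables**: for `F, G ∈ C_c^∞` and `t ≥ 0`,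
`∫ π G · P_t F dx = ∫ π (F∘Θ) · P_t(G∘Θ) dx`. -/
theorem pinnedChain_detailedBalance_smooth {F G : PhaseSpace N → ℝ} (hF : ContDiff ℝ ∞ F)
    (hFc : HasCompactSupport F) (hG : ContDiff ℝ ∞ G) (hGc : HasCompactSupport G) (t : ℝ≥0) :
    ∫ x, (pinnedChain ω₂ lam β γ).gibbsDensity N T x * G x *
        (∫ y, F y ∂((pinnedChain ω₂ lam β γ).transitionKernel N T T t x)) =
      ∫ x, (pinnedChain ω₂ lam β γ).gibbsDensity N T x * F (x.1, -x.2) *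
        (∫ y, G (y.1, -y.2) ∂((pinnedChain ω₂ lam β γ).transitionKernel N T T t x)) := by
  have hGt : ContDiff ℝ ∞ fun z : PhaseSpace N => G (z.1, -z.2) := contDiff_comp_momentumFlip hG
  have hGtc : HasCompactSupport fun z : PhaseSpace N => G (z.1, -z.2) := hasCompactSupport_comp_momentumFlip hGc
  have hF2 : ContDiff ℝ 2 F := hF.of_le (by norm_cast)
  have hGt2 : ContDiff ℝ 2 fun z : PhaseSpace N => G (z.1, -z.2) := hGt.of_le (by norm_cast)
  obtain ⟨CF, hCF⟩ : ∃ C, ∀ y, ‖F y‖ ≤ C := hF.continuous.bounded_above_of_compact_support hFc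
  obtain ⟨CG, hCG⟩ : ∃ C, ∀ y : PhaseSpace N, ‖G (y.1, -y.2)‖ ≤ C := hGt.continuous.bounded_above_of_compact_support hGtc
  have hCF' : ∀ y, |F y| ≤ CF := fun y => by rw [← Real.norm_eq_abs]; exact hCF y
  have hCG' : ∀ y : PhaseSpace N, |G y| ≤ CG := fun y => by
    have := hCG (y.1, -y.2)
    rw [← Real.norm_eq_abs]; simpa using this
  have hCF0 : 0 ≤ CF := (norm_nonneg _).trans (hCF 0)
  have hCG0 : 0 ≤ CG := (norm_nonneg _).trans (hCG 0)
  set π := (pinnedChain ω₂ lam β γ).gibbsDensity N T with hπ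
  have hπc : Continuous π := by
    rw [hπ]; exact Real.continuous_exp.comp (((pinnedChain_contDiff_hamiltonian ω₂ lam β γ N (n := 0)).continuous).neg.div_const T)
  have hπ0 : ∀ x, 0 < π x := fun x => (pinnedChain ω₂ lam β γ).gibbsDensity_pos N T x
  have hπΘ : ∀ x : PhaseSpace N, π (x.1, -x.2) = π x := fun x => by
    rw [hπ]; simp only [OscillatorChain.gibbsDensity, OscillatorChain.hamiltonian_neg_momentum]
  have hIπ : Integrable π := by rw [hπ]; exact pinnedChain_integrable_gibbsDensity hω hl hβ γ N hT
  have hflip : Continuous fun x : PhaseSpace N => ((x.1, -x.2) : PhaseSpace N) := continuous_fst.prodMk continuous_snd.neg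
  obtain ⟨u, hu⟩ : ∃ u : ℝ → PhaseSpace N → ℝ, u = fun r z =>
      ∫ y, F y ∂((pinnedChain ω₂ lam β γ).transitionKernel N T T r.toNNReal z) := ⟨_, rfl⟩
  obtain ⟨w, hw⟩ : ∃ w : ℝ → PhaseSpace N → ℝ, w = fun r z =>
      ∫ y, G (y.1, -y.2) ∂((pinnedChain ω₂ lam β γ).transitionKernel N T T r.toNNReal z) := ⟨_, rfl⟩
  have hux : ∀ r z, u r z = ∫ y, F y ∂((pinnedChain ω₂ lam β γ).transitionKernel N T T r.toNNReal z) :=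
    fun r z => by rw [hu]
  have hwx : ∀ r z, w r z = ∫ y, G (y.1, -y.2) ∂((pinnedChain ω₂ lam β γ).transitionKernel N T T r.toNNReal z) :=
    fun r z => by rw [hw]
  have huc : ∀ r, Continuous (u r) := fun r => by
    rw [hu]; exact pinnedChain_continuous_integral_transitionKernel hω hl hβ hγ.le N T T _ hF.continuous hCF
  have hwc : ∀ r, Continuous (w r) := fun r => by
    rw [hw]; exact pinnedChain_continuous_integral_transitionKernel hω hl hβ hγ.le N T T _ hGt.continuous hCG
  have hut : ∀ z, Continuous fun r => u r z := fun z => by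
    rw [hu]; exact pinnedChain_continuous_forecast_time hω hl hβ hγ T T hF.continuous hCF z
  have hwt : ∀ z, Continuous fun r => w r z := fun z => by
    rw [hw]; exact pinnedChain_continuous_forecast_time hω hl hβ hγ T T hGt.continuous hCG z
  have hub : ∀ r z, |u r z| ≤ CF := fun r z => by
    rw [hux]; exact pinnedChain_abs_forecast_le hω hl hβ hγ.le N T T hCF' _ z
  have hwb : ∀ r z, |w r z| ≤ CG := fun r z => by
    rw [hwx]; exact pinnedChain_abs_forecast_le hω hl hβ hγ.le N T T (fun y => hCG' _) _ z
  have hu0 : ∀ z, u 0 z = F z := fun z => by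
    rw [hux]; exact pinnedChain_integral_transitionKernel_zero hω hl hβ hγ T T hF.continuous z
  have hw0 : ∀ z, w 0 z = G (z.1, -z.2) := fun z => by
    rw [hwx]; exact pinnedChain_integral_transitionKernel_zero hω hl hβ hγ T T hGt.continuous z
  set tt : ℝ := (t : ℝ) with htt
  have htt0 : 0 ≤ tt := t.coe_nonneg
  have hgoal_form : ∫ x, π x * G x * u tt x = ∫ x, π x * F (x.1, -x.2) * w tt x := by
    rcases eq_or_lt_of_le htt0 with htz | htpos
    · -- `t = 0`
      rw [← htz]
      simp only [hu0, hw0]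
      have h := integral_comp_momentumReversal N fun x => π x * G x * F x
      simp only [hπΘ] at h
      rw [← h]
      exact integral_congr_ae (Eventually.of_forall fun x => by ring)
    · -- `t > 0`: the interpolation argument
      obtain ⟨Ψ, hΨ⟩ : ∃ Ψ : ℝ → ℝ, Ψ = fun s => ∫ x, π x * (w (tt - s) (x.1, -x.2) * u s x) := ⟨_, rfl⟩
      have hstepA : ∀ s₀ : ℝ, 0 < s₀ → 2 * s₀ ≤ tt → Ψ (tt - s₀) = Ψ s₀ := by
        intro s₀ hs₀ h2s₀
        obtain ⟨C₁, hC₁0, hC₁⟩ := pinnedChain_integral_gibbs_carreDuChamp_cutoff_le hω hl hβ hγ hN hT (ω₂ := ω₂)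
        obtain ⟨C₂, hC₂0, hC₂⟩ := pinnedChain_integral_gibbs_abs_generator_cutoff_le hω hl hβ hγ hN hT (ω₂ := ω₂)
        obtain ⟨CE, hCE0, hCE⟩ := pinnedChain_energy_estimate_cutoff hω hl hβ hγ hN hT hGt hGtc
        obtain ⟨ΨR, hΨR⟩ : ∃ ΨR : ℝ → ℝ → ℝ, ΨR = fun R s => ∫ x, π x *
            smoothCutoff ((pinnedChain ω₂ lam β γ).hamiltonian N x / R) * (w (tt - s) (x.1, -x.2) * u s x) := ⟨_, rfl⟩
        have hA1 : ∀ η : ℝ, 0 < η → ∀ R : ℝ, 1 ≤ R →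
            |ΨR R (tt - s₀) - ΨR R s₀| ≤ tt * (CF * CG * C₂ + CF * (1 / (2 * η)) * C₁) / R + CF * (η / 2) * (CE * (1 + tt)) := by
          intro η hη R hR
          have hR0 : 0 < R := by linarith
          obtain ⟨gF, hgF⟩ : ∃ g : ℝ → PhaseSpace N → ℝ, g = fun r z => ∫ y, (pinnedChain ω₂ lam β γ).generator N T T F y
              ∂((pinnedChain ω₂ lam β γ).transitionKernel N T T r.toNNReal z) := ⟨_, rfl⟩
          obtain ⟨gG, hgG⟩ : ∃ g : ℝ → PhaseSpace N → ℝ, g = fun r z =>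
              ∫ y, (pinnedChain ω₂ lam β γ).generator N T T (fun z => G (z.1, -z.2)) y
                ∂((pinnedChain ω₂ lam β γ).transitionKernel N T T r.toNNReal z) := ⟨_, rfl⟩
          obtain ⟨χ, hχ⟩ : ∃ χ : PhaseSpace N → ℝ, χ = fun x => smoothCutoff ((pinnedChain ω₂ lam β γ).hamiltonian N x / R) :=
            ⟨_, rfl⟩
          obtain ⟨D, hD⟩ : ∃ D : ℝ → ℝ, D = fun s => ∫ x, π x * χ x *
              (-(gG (tt - s) (x.1, -x.2)) * u s x + w (tt - s) (x.1, -x.2) * gF s x) := ⟨_, rfl⟩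
          have hLFc : Continuous ((pinnedChain ω₂ lam β γ).generator N T T F) :=
            (pinnedChain ω₂ lam β γ).continuous_generator (pinnedChain_contDiff_U ω₂ lam β γ)
              (pinnedChain_contDiff_V ω₂ lam β γ) N T T hF2
          have hLGc : Continuous ((pinnedChain ω₂ lam β γ).generator N T T fun z => G (z.1, -z.2)) :=
            (pinnedChain ω₂ lam β γ).continuous_generator (pinnedChain_contDiff_U ω₂ lam β γ)
              (pinnedChain_contDiff_V ω₂ lam β γ) N T T hGt2
          obtain ⟨CLF, hCLF⟩ := (pinnedChain ω₂ lam β γ).exists_bound_generator (pinnedChain_contDiff_U ω₂ lam β γ)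
            (pinnedChain_contDiff_V ω₂ lam β γ) N T T hF2 hFc
          obtain ⟨CLG, hCLG⟩ := (pinnedChain ω₂ lam β γ).exists_bound_generator (pinnedChain_contDiff_U ω₂ lam β γ)
            (pinnedChain_contDiff_V ω₂ lam β γ) N T T hGt2 hGtc
          have hgFt : ∀ z, Continuous fun r => gF r z := fun z => by
            rw [hgF]; exact pinnedChain_continuous_forecast_time hω hl hβ hγ T T hLFc hCLF z
          have hgGt : ∀ z, Continuous fun r => gG r z := fun z => by
            rw [hgG]; exact pinnedChain_continuous_forecast_time hω hl hβ hγ T T hLGc hCLG z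
          have hgFc : ∀ r, Continuous (gF r) := fun r => by
            rw [hgF]; exact pinnedChain_continuous_integral_transitionKernel hω hl hβ hγ.le N T T _ hLFc hCLF
          have hgGc : ∀ r, Continuous (gG r) := fun r => by
            rw [hgG]; exact pinnedChain_continuous_integral_transitionKernel hω hl hβ hγ.le N T T _ hLGc hCLG
          have hgFb : ∀ r z, ‖gF r z‖ ≤ CLF := fun r z => by
            rw [hgF]; beta_reduce; rw [Real.norm_eq_abs]
            exact pinnedChain_abs_forecast_le hω hl hβ hγ.le N T T
              (fun y => (Real.norm_eq_abs _).symm.le.trans (hCLF y)) _ z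
          have hgGb : ∀ r z, ‖gG r z‖ ≤ CLG := fun r z => by
            rw [hgG]; beta_reduce; rw [Real.norm_eq_abs]
            exact pinnedChain_abs_forecast_le hω hl hβ hγ.le N T T
              (fun y => (Real.norm_eq_abs _).symm.le.trans (hCLG y)) _ z
          have hCLF0 : 0 ≤ CLF := (norm_nonneg _).trans (hCLF 0)
          have hCLG0 : 0 ≤ CLG := (norm_nonneg _).trans (hCLG 0)
          have hχc' : Continuous χ := by rw [hχ]; exact (pinnedChain_contDiff_cutoff N γ R (ω₂ := ω₂) (lam := lam) (β := β)).continuous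
          have hχs : HasCompactSupport χ := by rw [hχ]; exact pinnedChain_hasCompactSupport_cutoff hω hl hβ N γ hR0
          have hDc : Continuous D := by
            rw [hD]
            have hbint : Integrable (fun x => |π x * χ x| * (CLG * CF + CG * CLF)) :=
              ((hπc.mul hχc').abs.mul continuous_const).integrable_of_hasCompactSupport (hχs.mul_left.norm.mul_right)
            refine continuous_of_dominated (fun s => ?_) (fun s => Eventually.of_forall fun x => ?_) hbint
              (Eventually.of_forall fun x => ?_)
            · exact ((hπc.mul hχc').mul ((((hgGc (tt - s)).comp hflip).neg.mul (huc s)).add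
                (((hwc (tt - s)).comp hflip).mul (hgFc s)))).aestronglyMeasurable
            · rw [norm_mul, Real.norm_eq_abs]
              refine mul_le_mul_of_nonneg_left ?_ (abs_nonneg _)
              calc _ ≤ ‖-(gG (tt - s) (x.1, -x.2)) * u s x‖ + ‖w (tt - s) (x.1, -x.2) * gF s x‖ := norm_add_le _ _
                _ ≤ CLG * CF + CG * CLF := by
                    rw [norm_mul, norm_mul, norm_neg, Real.norm_eq_abs (u s x), Real.norm_eq_abs (w _ _)]
                    exact add_le_add (mul_le_mul (hgGb _ _) (hub _ _) (abs_nonneg _) hCLG0)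
                      (mul_le_mul (hwb _ _) (hgFb _ _) (norm_nonneg _) hCG0)
            · have h1 : Continuous fun s => gG (tt - s) (x.1, -x.2) := (hgGt (x.1, -x.2)).comp (continuous_const.sub continuous_id)
              have h2 : Continuous fun s => w (tt - s) (x.1, -x.2) := (hwt (x.1, -x.2)).comp (continuous_const.sub continuous_id)
              exact (continuous_const.mul ((h1.neg.mul (hut x)).add (h2.mul (hgFt x))))
          have hderiv : ∀ s, 0 < s → s < tt → HasDerivAt (ΨR R) (D s) s := by
            intro s hs hst
            have h := pinnedChain_hasDerivAt_dualityFunctional hω hl hβ hγ hN hT hF hFc hG hGc hR0 hs hst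
            rw [hΨR, hD, hχ, hu, hw, hgF, hgG]
            exact h
          obtain ⟨e, he⟩ : ∃ e : ℝ → ℝ, e = fun r => ∫ x, π x * (smoothCutoff ((pinnedChain ω₂ lam β γ).hamiltonian N x / (4 * R)) ^ 2 *
              carreDuChamp ((pinnedChain ω₂ lam β γ).bathVecL N T) ((pinnedChain ω₂ lam β γ).bathVecR N T)
                (w r) (w r) x) := ⟨_, rfl⟩
          have hec : ContinuousOn e (Set.Ioi 0) := by
            have h := pinnedChain_continuousOn_energyDensity hω hl hβ hγ hN hT hGt hGtc
              (pinnedChain_contDiff_cutoff N γ (4 * R)) (pinnedChain_hasCompactSupport_cutoff hω hl hβ N γ (by positivity))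
            rw [he, hw]; exact h
          have hDb : ∀ s, 0 < s → s < tt → |D s| ≤ CF * CG * (C₂ / R) + CF * (1 / (2 * η) * (C₁ / R ^ 2) +
              η / 2 * e (tt - s)) := by
            intro s hs hst
            have h1 := pinnedChain_dualityDerivative_eq hω hl hβ hγ hN hT hF hFc hG hGc hR0 hs hst
            have h2 := pinnedChain_abs_dualityDerivative_le hω hl hβ hγ hN hT hF hG hGc hR0 hη hst hCF' hCG'
            have key : |D s| ≤ CF * CG * (∫ x, (pinnedChain ω₂ lam β γ).gibbsDensity N T x *
                |(pinnedChain ω₂ lam β γ).generator N T T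
                  (fun z => smoothCutoff ((pinnedChain ω₂ lam β γ).hamiltonian N z / R)) x|) +
                CF * (1 / (2 * η) * (∫ x, (pinnedChain ω₂ lam β γ).gibbsDensity N T x *
                  carreDuChamp ((pinnedChain ω₂ lam β γ).bathVecL N T) ((pinnedChain ω₂ lam β γ).bathVecR N T)
                    (fun z => smoothCutoff ((pinnedChain ω₂ lam β γ).hamiltonian N z / R))
                    (fun z => smoothCutoff ((pinnedChain ω₂ lam β γ).hamiltonian N z / R)) x) +
                  η / 2 * ∫ x, (pinnedChain ω₂ lam β γ).gibbsDensity N T x *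
                    (smoothCutoff ((pinnedChain ω₂ lam β γ).hamiltonian N x / (4 * R)) ^ 2 *
                      carreDuChamp ((pinnedChain ω₂ lam β γ).bathVecL N T) ((pinnedChain ω₂ lam β γ).bathVecR N T)
                        (fun z => ∫ y, G (y.1, -y.2) ∂((pinnedChain ω₂ lam β γ).transitionKernel N T T (tt - s).toNNReal z))
                        (fun z => ∫ y, G (y.1, -y.2) ∂((pinnedChain ω₂ lam β γ).transitionKernel N T T (tt - s).toNNReal z)) x)) := by
              rw [hD]
              beta_reduce
              rw [hχ, hu, hw, hgF, hgG, hπ]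
              beta_reduce
              rw [h1]
              exact h2
            have hI3 : (∫ x, (pinnedChain ω₂ lam β γ).gibbsDensity N T x *
                (smoothCutoff ((pinnedChain ω₂ lam β γ).hamiltonian N x / (4 * R)) ^ 2 *
                  carreDuChamp ((pinnedChain ω₂ lam β γ).bathVecL N T) ((pinnedChain ω₂ lam β γ).bathVecR N T)
                    (fun z => ∫ y, G (y.1, -y.2) ∂((pinnedChain ω₂ lam β γ).transitionKernel N T T (tt - s).toNNReal z))
                    (fun z => ∫ y, G (y.1, -y.2) ∂((pinnedChain ω₂ lam β γ).transitionKernel N T T (tt - s).toNNReal z)) x)) =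
                e (tt - s) := by
              rw [he, hw]
            rw [hI3] at key
            have i1 := hC₂ R hR
            have i2 := hC₁ R hR0
            have j1 := mul_le_mul_of_nonneg_left i1 (mul_nonneg hCF0 hCG0)
            have j2 := mul_le_mul_of_nonneg_left i2 (by positivity : (0 : ℝ) ≤ 1 / (2 * η))
            have j3 := mul_le_mul_of_nonneg_left (add_le_add_right j2 (η / 2 * e (tt - s))) hCF0
            linarith [key, j1, j3]
          have h4R : 1 ≤ 4 * R := by linarith
          have heint : ∫ r in s₀..(tt - s₀), e r ≤ CE * (1 + tt) := by
            have h := hCE (4 * R) h4R s₀ (tt - s₀) hs₀ (by linarith)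
            rw [he, hw]
            refine h.trans ?_
            exact mul_le_mul_of_nonneg_left (by linarith) hCE0
          have hIcc : ∀ s ∈ Set.Icc s₀ (tt - s₀), 0 < s ∧ s < tt := fun s hs => ⟨lt_of_lt_of_le hs₀ hs.1, by linarith [hs.2]⟩
          have hFTC : ∫ s in s₀..(tt - s₀), D s = ΨR R (tt - s₀) - ΨR R s₀ := by
            refine intervalIntegral.integral_eq_sub_of_hasDerivAt (fun s hs => ?_) (hDc.intervalIntegrable _ _)
            rw [Set.uIcc_of_le (by linarith)] at hs
            exact hderiv s (hIcc s hs).1 (hIcc s hs).2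
          have hesub : ∫ s in s₀..(tt - s₀), e (tt - s) = ∫ r in s₀..(tt - s₀), e r := by
            rw [intervalIntegral.integral_comp_sub_left (fun r => e r) tt]
            congr 1; ring
          have heci : IntervalIntegrable (fun s => e (tt - s)) volume s₀ (tt - s₀) := by
            refine (ContinuousOn.intervalIntegrable_of_Icc (by linarith) ?_)
            refine hec.comp (continuousOn_const.sub continuousOn_id) fun s hs => ?_
            simp only [Set.mem_Ioi]; linarith [hs.2]
          set K₀ : ℝ := CF * CG * (C₂ / R) + CF * (1 / (2 * η) * (C₁ / R ^ 2)) with hK₀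
          have hmono : ∫ s in s₀..(tt - s₀), |D s| ≤ ∫ s in s₀..(tt - s₀), (K₀ + CF * (η / 2) * e (tt - s)) := by
            refine intervalIntegral.integral_mono_on (by linarith) (hDc.abs.intervalIntegrable _ _)
              (intervalIntegrable_const.add (heci.const_mul _)) fun s hs => ?_
            have h := hDb s (hIcc s hs).1 (hIcc s hs).2
            rw [hK₀]
            linarith [h]
          rw [intervalIntegral.integral_add intervalIntegrable_const (heci.const_mul _), intervalIntegral.integral_const,
            intervalIntegral.integral_const_mul, hesub, smul_eq_mul] at hmono
          have habs : |ΨR R (tt - s₀) - ΨR R s₀| ≤ ∫ s in s₀..(tt - s₀), |D s| := by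
            rw [← hFTC]
            exact intervalIntegral.abs_integral_le_integral_abs (by linarith)
          refine habs.trans (hmono.trans ?_)
          have hK₀0 : 0 ≤ K₀ := by rw [hK₀]; positivity
          have hRR : C₁ / R ^ 2 ≤ C₁ / R := by
            rw [div_le_div_iff₀ (by positivity) hR0]
            have h1 : R ≤ R ^ 2 := by nlinarith
            nlinarith [mul_le_mul_of_nonneg_left h1 hC₁0]
          have hK₀' : K₀ ≤ (CF * CG * C₂ + CF * (1 / (2 * η)) * C₁) / R := by
            rw [hK₀]
            have : CF * (1 / (2 * η) * (C₁ / R ^ 2)) ≤ CF * (1 / (2 * η) * (C₁ / R)) :=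
              mul_le_mul_of_nonneg_left (mul_le_mul_of_nonneg_left hRR (by positivity)) hCF0
            calc _ ≤ CF * CG * (C₂ / R) + CF * (1 / (2 * η) * (C₁ / R)) := by linarith
              _ = _ := by ring
          have hts : tt - s₀ - s₀ ≤ tt := by linarith
          have hts0 : 0 ≤ tt - s₀ - s₀ := by linarith
          have m1 : (tt - s₀ - s₀) * K₀ ≤ tt * ((CF * CG * C₂ + CF * (1 / (2 * η)) * C₁) / R) :=
            mul_le_mul hts hK₀' hK₀0 htt0
          have m2 : CF * (η / 2) * ∫ r in s₀..(tt - s₀), e r ≤ CF * (η / 2) * (CE * (1 + tt)) :=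
            mul_le_mul_of_nonneg_left heint (by positivity : 0 ≤ CF * (η / 2))
          have m3 : tt * ((CF * CG * C₂ + CF * (1 / (2 * η)) * C₁) / R) =
              tt * (CF * CG * C₂ + CF * (1 / (2 * η)) * C₁) / R := by ring
          linarith [m1, m2, m3]
        have hlim : ∀ s : ℝ, Tendsto (fun n : ℕ => ΨR (n + 1) s) atTop (𝓝 (Ψ s)) := by
          intro s
          rw [hΨR, hΨ]
          beta_reduce
          refine tendsto_integral_of_dominated_convergence (fun x => π x * (CG * CF)) (fun n => ?_) (hIπ.mul_const _) ?_ ?_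
          · exact ((hπc.mul (pinnedChain_contDiff_cutoff N γ ((n : ℝ) + 1) (ω₂ := ω₂) (lam := lam) (β := β)).continuous).mul
              (((hwc _).comp hflip).mul (huc s))).aestronglyMeasurable
          · intro n
            refine Eventually.of_forall fun x => ?_
            rw [Real.norm_eq_abs, abs_mul, abs_mul, abs_of_nonneg (hπ0 x).le, abs_of_nonneg (smoothCutoff_nonneg _), abs_mul]
            calc _ ≤ π x * 1 * (CG * CF) := mul_le_mul (mul_le_mul_of_nonneg_left (smoothCutoff_le_one _) (hπ0 x).le)
                  (mul_le_mul (hwb _ _) (hub _ _) (abs_nonneg _) hCG0) (by positivity)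
                  (by rw [mul_one]; exact (hπ0 x).le)
              _ = _ := by ring
          · refine Eventually.of_forall fun x => ?_
            have hev : ∀ᶠ n : ℕ in atTop, π x * smoothCutoff ((pinnedChain ω₂ lam β γ).hamiltonian N x / ((n : ℝ) + 1)) *
                (w (tt - s) (x.1, -x.2) * u s x) = π x * (w (tt - s) (x.1, -x.2) * u s x) := by
              obtain ⟨n₀, hn₀⟩ := exists_nat_ge ((pinnedChain ω₂ lam β γ).hamiltonian N x)
              filter_upwards [eventually_ge_atTop n₀] with n hn
              have hle : (pinnedChain ω₂ lam β γ).hamiltonian N x / ((n : ℝ) + 1) ≤ 1 := by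
                rw [div_le_one (by positivity)]
                have : (n₀ : ℝ) ≤ n := by exact_mod_cast hn
                linarith
              rw [smoothCutoff_of_le_one hle, mul_one]
            exact tendsto_const_nhds.congr' (hev.mono fun n hn => hn.symm)
        have habs0 : |Ψ (tt - s₀) - Ψ s₀| ≤ 0 := by
          refine le_of_forall_pos_le_add fun ε hε => ?_
          rw [zero_add]
          set η : ℝ := ε / (CF * (CE * (1 + tt)) / 2 + 1) with hη
          have hden : 0 < CF * (CE * (1 + tt)) / 2 + 1 := by positivity
          have hη0 : 0 < η := div_pos hε hden
          have hηε : CF * (η / 2) * (CE * (1 + tt)) ≤ ε := by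
            have e1 : CF * (η / 2) * (CE * (1 + tt)) = ε * ((CF * (CE * (1 + tt)) / 2) / (CF * (CE * (1 + tt)) / 2 + 1)) := by
              rw [hη]; field_simp
            rw [e1]
            have : (CF * (CE * (1 + tt)) / 2) / (CF * (CE * (1 + tt)) / 2 + 1) ≤ 1 := by
              rw [div_le_one hden]; linarith
            nlinarith
          have hseq : Tendsto (fun n : ℕ => |ΨR (n + 1) (tt - s₀) - ΨR (n + 1) s₀|) atTop (𝓝 |Ψ (tt - s₀) - Ψ s₀|) :=
            ((hlim (tt - s₀)).sub (hlim s₀)).abs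
          have hbseq : Tendsto (fun n : ℕ => tt * (CF * CG * C₂ + CF * (1 / (2 * η)) * C₁) / ((n : ℝ) + 1) +
              CF * (η / 2) * (CE * (1 + tt))) atTop (𝓝 (0 + CF * (η / 2) * (CE * (1 + tt)))) := by
            refine Tendsto.add ?_ tendsto_const_nhds
            have h := tendsto_one_div_add_atTop_nhds_zero_nat.const_mul (tt * (CF * CG * C₂ + CF * (1 / (2 * η)) * C₁))
            rw [mul_zero] at h
            refine h.congr fun n => ?_
            field_simp
          have hle := le_of_tendsto_of_tendsto hseq hbseq (Eventually.of_forall fun n => hA1 η hη0 ((n : ℝ) + 1) (by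
            have : (0 : ℝ) ≤ n := n.cast_nonneg
            linarith))
          rw [zero_add] at hle
          exact hle.trans hηε
        have h0 := abs_nonpos_iff.1 habs0
        linarith
      have hB1 : Tendsto Ψ (𝓝 0) (𝓝 (∫ x, π x * (w tt (x.1, -x.2) * F x))) := by
        rw [hΨ]
        refine tendsto_integral_filter_of_dominated_convergence (fun x => π x * (CG * CF)) ?_ ?_ (hIπ.mul_const _) ?_
        · exact Eventually.of_forall fun s => (hπc.mul (((hwc _).comp hflip).mul (huc s))).aestronglyMeasurable
        · refine Eventually.of_forall fun s => Eventually.of_forall fun x => ?_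
          rw [Real.norm_eq_abs, abs_mul, abs_of_nonneg (hπ0 x).le, abs_mul]
          exact mul_le_mul_of_nonneg_left (mul_le_mul (hwb _ _) (hub _ _) (abs_nonneg _) hCG0) (hπ0 x).le
        · refine Eventually.of_forall fun x => ?_
          have h1 : Tendsto (fun s => w (tt - s) (x.1, -x.2)) (𝓝 0) (𝓝 (w tt (x.1, -x.2))) := by
            have h1c : Continuous fun s : ℝ => w (tt - s) (x.1, -x.2) :=
              (hwt (x.1, -x.2)).comp (continuous_const.sub continuous_id)
            simpa using h1c.tendsto 0
          have h2 : Tendsto (fun s => u s x) (𝓝 0) (𝓝 (F x)) := by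
            have := (hut x).tendsto 0
            rwa [hu0] at this
          exact (h1.mul h2).const_mul _
      have hB2 : Tendsto (fun s => Ψ (tt - s)) (𝓝 0) (𝓝 (∫ x, π x * G x * u tt x)) := by
        rw [hΨ]
        beta_reduce
        simp only [sub_sub_cancel]
        have e : (∫ x, π x * G x * u tt x) = ∫ x, π x * (w 0 (x.1, -x.2) * u tt x) := by
          refine integral_congr_ae (Eventually.of_forall fun x => ?_)
          simp only [hw0, neg_neg, Prod.mk.eta]; ring
        rw [e]
        refine tendsto_integral_filter_of_dominated_convergence (fun x => π x * (CG * CF)) ?_ ?_ (hIπ.mul_const _) ?_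
        · exact Eventually.of_forall fun s => (hπc.mul (((hwc _).comp hflip).mul (huc _))).aestronglyMeasurable
        · refine Eventually.of_forall fun s => Eventually.of_forall fun x => ?_
          rw [Real.norm_eq_abs, abs_mul, abs_of_nonneg (hπ0 x).le, abs_mul]
          exact mul_le_mul_of_nonneg_left (mul_le_mul (hwb _ _) (hub _ _) (abs_nonneg _) hCG0) (hπ0 x).le
        · refine Eventually.of_forall fun x => ?_
          have h1 : Tendsto (fun s => w s (x.1, -x.2)) (𝓝 0) (𝓝 (w 0 (x.1, -x.2))) := (hwt (x.1, -x.2)).tendsto 0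
          have h2 : Tendsto (fun s => u (tt - s) x) (𝓝 0) (𝓝 (u tt x)) := by
            have h2c : Continuous fun s : ℝ => u (tt - s) x := (hut x).comp (continuous_const.sub continuous_id)
            simpa using h2c.tendsto 0
          exact (h1.mul h2).const_mul _
      have hB1' : Tendsto Ψ (𝓝[>] 0) (𝓝 (∫ x, π x * (w tt (x.1, -x.2) * F x))) := hB1.mono_left nhdsWithin_le_nhds
      have hB2' : Tendsto (fun s => Ψ (tt - s)) (𝓝[>] 0) (𝓝 (∫ x, π x * G x * u tt x)) := hB2.mono_left nhdsWithin_le_nhds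
      have hev : ∀ᶠ s in 𝓝[>] (0 : ℝ), Ψ (tt - s) = Ψ s := by
        have hmem : Set.Ioo (0 : ℝ) (tt / 2) ∈ 𝓝[>] (0 : ℝ) := Ioo_mem_nhdsGT (by positivity)
        filter_upwards [hmem] with s hs
        exact hstepA s hs.1 (by linarith [hs.2])
      have hlimeq := tendsto_nhds_unique (hB2'.congr' hev) hB1'
      rw [hlimeq]
      have hflipI := integral_comp_momentumReversal N fun x => π x * F (x.1, -x.2) * w tt x
      simp only [hπΘ, neg_neg, Prod.mk.eta] at hflipI
      rw [← hflipI]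
      exact integral_congr_ae (Eventually.of_forall fun x => by ring)
  rw [hu, hw] at hgoal_form
  simpa only [htt, Real.toNNReal_coe] using hgoal_form

end Core

end Summit.AtomisticToContinuum.FouriersLaw.Theorems

end
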